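import Literature.Analysis.FluidPDE.Tao2016AveragedNS.SplitCascadeAsymPast
import Literature.Analysis.FluidPDE.Tao2016AveragedNS.SplitCascadeScaleOneBootstrap
import HarnessLib

/-!
# The split Prop. 6.5: the cumulative `a`-asymmetry of the fresh shell over the past (`n₀`-smallness)

T. Tao, *Finite time blowup for an averaged three-dimensional Navier–Stokes equation*,
arXiv:1402.0290v3, §6.4 Lemma 6.7, §6.6 (6.118)/(6.109).
HONEST FRAMING: statements about the SPLIT cascade model system; nothing here proves the split
Prop. 6.5 and nothing here concerns the true Navier–Stokes equations.

From the pointwise past bound of `SplitCascadeAsymPast.lean`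
(`|Z̃_{a,1}| ≤ Z₁(1+ε₀)^{(248/100)k}` on the `k`-th past interval, `Z₁ = e^{B_past}4√3C₁(1+ε₀)^{-n₀/2}K⁻¹⁵C₃G₂₄₈`)
and Lemma 6.7's summation with decay `2·(248/100) - 251/100 = 245/100` (time-frozen extension, as in
`integral_sq_c_one_past_le`): `∫_{τ₀}^t Z̃²_{a,1} ≤ Z₁² C₃ G₂₄₅ (1+ε₀)^{(245/100)k}` — the past half of the
`a`-asymmetry integral kept by (6.118)♯/(6.109)♯ (`SplitCascadeScaleOneClose/Regime.lean`,
`SplitCascadeSmallScaleOneAbsorbed.lean`) is `O(C₁²(1+ε₀)^{-n₀})`, i.e. `n₀`-small. (The present half is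
`≤ 100ζ²` from the window certificate.)

## References

* T. Tao, arXiv:1402.0290v3, §6.4 Lemma 6.7; §6.6 (6.118). [`Tao2016AveragedNS`]
-/

noncomputable section

open Set MeasureTheory intervalIntegral

namespace Literature.Analysis.FluidPDE

namespace Tao2016AveragedNS

open TaoCascade
open Literature.Analysis.ODE

section AsymPastIntegral

variable {γ ε₀ K ε C₁ C₂ C₃ : ℝ} {n₀ N : ℤ} {ηp : ℤ → ℝ} {βp : ℕ → ℝ} {τ : ℤ → ℝ}
  {Y : Fin 4 → ℤ → ℝ → ℝ} {W : Fin 3 → ℤ → ℝ → ℝ} {F : ℤ → ℝ → ℝ}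

/-- **`|Z̃_{a,1}|` on the `k`-th past interval** (a component of `asym_one_past_le`).
[cite: Tao2016AveragedNS, §6.6 (6.118)] -/
theorem RescaledSplitHypotheses.absW_a_one_past_le
    (h : RescaledSplitHypotheses γ ε₀ K ε C₁ C₂ C₃ n₀ N ηp βp τ Y W F) (hε₀ : 0 < ε₀) (hε₀1 : ε₀ < 1)
    (hK : 1 ≤ K) (hε : 0 < ε) (hC₁ : 0 ≤ C₁) (hC₃ : 0 ≤ C₃)
    {k : ℤ} (hk : n₀ - N < k) (hk0 : k ≤ 0) {t : ℝ} (ht : t ∈ Icc (τ (k - 1)) (τ k)) :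
    |W 0 1 t| ≤
      Real.exp ((6 * (ε + ε ^ 2 + 2 * (ε ^ 2)⁻¹ + ε⁻¹ * K ^ 10) + 36 * K) * Real.sqrt 2 *
          ((K ^ 15)⁻¹ * C₃ * geomConst ε₀ ((248 : ℝ) / 100))) *
        ((4 * Real.sqrt 3 * C₁ * (1 + ε₀) ^ (-(n₀ : ℝ) / 2)) *
          ((K ^ 15)⁻¹ * C₃ * geomConst ε₀ ((248 : ℝ) / 100)) * (1 + ε₀) ^ ((248 : ℝ) / 100 * k)) := by
  refine le_trans ?_ (h.asym_one_past_le hε₀ hε₀1 hK hε hC₁ hC₃ hk hk0 ht)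
  rw [← Real.sqrt_sq_eq_abs]
  apply Real.sqrt_le_sqrt
  rw [Fin.sum_univ_three]
  nlinarith [sq_nonneg (W 1 1 t), sq_nonneg (W 2 1 t)]

/-- **The cumulative `a`-asymmetry of the fresh shell over the past is `n₀`-small**: for
`n₀ - N < k ≤ 0` and `t ∈ [τ_{k-1}, τ_k]`,
`∫_{τ₀}^t Z̃²_{a,1} ≤ Z₁² C₃ geomConst ε₀ (245/100) (1+ε₀)^{(245/100)k}` with `Z₁` the level of
`absW_a_one_past_le`. [cite: Tao2016AveragedNS, §6.4 Lemma 6.7; §6.6 (6.118)] -/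
theorem RescaledSplitHypotheses.integral_sqW_a_one_past_le
    (h : RescaledSplitHypotheses γ ε₀ K ε C₁ C₂ C₃ n₀ N ηp βp τ Y W F) (hε₀ : 0 < ε₀) (hε₀1 : ε₀ < 1)
    (hK : 1 ≤ K) (hε : 0 < ε) (hC₁ : 0 ≤ C₁) (hC₃ : 0 ≤ C₃)
    {k : ℤ} (hk : n₀ - N < k) (hk0 : k ≤ 0) {t : ℝ} (ht : t ∈ Icc (τ (k - 1)) (τ k)) :
    ∫ s in (τ (n₀ - N))..t, W 0 1 s ^ 2 ≤
      (Real.exp ((6 * (ε + ε ^ 2 + 2 * (ε ^ 2)⁻¹ + ε⁻¹ * K ^ 10) + 36 * K) * Real.sqrt 2 *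
          ((K ^ 15)⁻¹ * C₃ * geomConst ε₀ ((248 : ℝ) / 100))) *
        ((4 * Real.sqrt 3 * C₁ * (1 + ε₀) ^ (-(n₀ : ℝ) / 2)) *
          ((K ^ 15)⁻¹ * C₃ * geomConst ε₀ ((248 : ℝ) / 100)))) ^ 2 *
        C₃ * geomConst ε₀ ((245 : ℝ) / 100) * (1 + ε₀) ^ ((245 : ℝ) / 100 * k) := by
  have h0 : (0 : ℝ) < 1 + ε₀ := by linarith
  have hτt : τ (n₀ - N) ≤ t := (h.tau_init_le_tau (by omega) (by omega)).trans ht.1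
  have htk : t ≤ τ k := ht.2
  have hk0' : τ k ≤ 0 := h.tau_le k (by omega) hk0
  have hτk : τ (n₀ - N) ≤ τ k := h.tau_init_le_tau (by omega) hk0
  set D : ℝ := Real.exp ((6 * (ε + ε ^ 2 + 2 * (ε ^ 2)⁻¹ + ε⁻¹ * K ^ 10) + 36 * K) * Real.sqrt 2 *
      ((K ^ 15)⁻¹ * C₃ * geomConst ε₀ ((248 : ℝ) / 100))) *
    ((4 * Real.sqrt 3 * C₁ * (1 + ε₀) ^ (-(n₀ : ℝ) / 2)) *
      ((K ^ 15)⁻¹ * C₃ * geomConst ε₀ ((248 : ℝ) / 100))) with hD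
  have hD0 : 0 ≤ D := by
    have := geomConst_pos hε₀ (s := (248 : ℝ) / 100) (by norm_num)
    have hK0 : 0 < K := by linarith
    positivity
  have hlev : ∀ {j : ℤ} (hj : n₀ - N < j) (hj0 : j ≤ 0) {s : ℝ} (hs : s ∈ Icc (τ (j - 1)) (τ j)),
      |W 0 1 s| ≤ D * (1 + ε₀) ^ ((248 : ℝ) / 100 * j) := by
    intro j hj hj0 s hs
    have := h.absW_a_one_past_le hε₀ hε₀1 hK hε hC₁ hC₃ hj hj0 hs
    simp only [hD]
    calc _ ≤ _ := this
      _ = _ := by ring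
  -- the frozen extension
  set cf : ℝ → ℝ := fun s => |W 0 1 (min s t)| with hcf
  have hcfc : ContinuousOn cf (Icc (τ (n₀ - N)) 0) :=
    (continuousOn_comp_min (b := t) (h.continuousOn_W 0 1 le_rfl) ⟨hτt, le_rfl⟩).abs
  have hbound : ∀ j, n₀ - N < j → j ≤ 0 → ∀ s ∈ Icc (τ (j - 1)) (τ j),
      cf s ^ 2 ≤ D ^ 2 * (1 + ε₀) ^ (((245 : ℝ) / 100 + (251 : ℝ) / 100) * j) := by
    intro j hj hj0 s hs
    have hexp : (1 + ε₀) ^ (((245 : ℝ) / 100 + (251 : ℝ) / 100) * j) =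
        ((1 + ε₀) ^ ((248 : ℝ) / 100 * j)) ^ 2 := by
      rw [← Real.rpow_natCast, ← Real.rpow_mul h0.le]; congr 1; push_cast; ring
    rw [hexp, ← mul_pow]
    have hcf0 : 0 ≤ cf s := by simp only [hcf]; positivity
    have hcf_le : cf s ≤ D * (1 + ε₀) ^ ((248 : ℝ) / 100 * j) := by
      simp only [hcf]
      rcases le_or_gt s t with hst | hst
      · rw [min_eq_left hst]
        exact hlev hj hj0 hs
      · rw [min_eq_right hst.le]
        have hkj : k ≤ j := h.piece_index_le hj hk0 hs ht hst
        calc |W 0 1 t| ≤ D * (1 + ε₀) ^ ((248 : ℝ) / 100 * k) := hlev hk hk0 ht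
          _ ≤ D * (1 + ε₀) ^ ((248 : ℝ) / 100 * j) :=
              mul_le_mul_of_nonneg_left (rpow_scale_mono hε₀.le (by norm_num) hkj) hD0
    exact pow_le_pow_left₀ hcf0 hcf_le 2
  have hsum := h.integral_past_le hε₀ hC₃ (F := fun s => cf s ^ 2) (hcfc.pow 2) (D := D ^ 2)
    (s := (245 : ℝ) / 100) (by positivity) (by norm_num) hbound (k := k) (by omega) hk0
  have heq : ∫ s in (τ (n₀ - N))..t, W 0 1 s ^ 2 = ∫ s in (τ (n₀ - N))..t, cf s ^ 2 := by
    apply integral_congr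
    intro s hs
    rw [uIcc_of_le hτt] at hs
    simp only [hcf, min_eq_left hs.2, sq_abs]
  have hmono : ∫ s in (τ (n₀ - N))..t, cf s ^ 2 ≤ ∫ s in (τ (n₀ - N))..(τ k), cf s ^ 2 := by
    apply integral_mono_interval le_rfl hτt htk
    · exact ae_restrict_of_forall_mem measurableSet_Ioc fun s _ => sq_nonneg _
    · exact ((hcfc.pow 2).mono (Icc_subset_Icc le_rfl hk0')).intervalIntegrable_of_Icc hτk
  rw [heq]
  calc ∫ s in (τ (n₀ - N))..t, cf s ^ 2 ≤ ∫ s in (τ (n₀ - N))..(τ k), cf s ^ 2 := hmono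
    _ ≤ D ^ 2 * C₃ * geomConst ε₀ ((245 : ℝ) / 100) * (1 + ε₀) ^ ((245 : ℝ) / 100 * k) := hsum

end AsymPastIntegral

end Tao2016AveragedNS

end Literature.Analysis.FluidPDE
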